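import Literature.NumberTheory.CubicFields.PsiFourierPrimitive
import Literature.NumberTheory.EllipticCurves.LeadingTermBSZResidueCountProofs
import HarnessLib

/-!
# The Fourier transform of `Ψ_{p²} = 𝟙_{p² ∣ Disc}`, III: content divisible by `p`
(Bhargava–Taniguchi–Thorne 2023, Prop. 5.2, the case "Content `p`": `|Ψ̂_{p²}(x)| = O(p⁻³)`, `p ≥ 5`)

Topic `Literature/NumberTheory/CubicFields`; continues `PsiFourierNormalForm.lean` / `PsiFourierPrimitive.lean`.
For `f = p f'` in the dual lattice with `f' ≢ 0 (mod p)` the fibre sums have no character and count points: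
`p⁸ Ψ̂_{p²}(ι⁻¹ f) = p³ Σ_{Disc(y₀)=0} e(⟨f', y₀⟩/p) + (p⁴ − p³) Σ_{∇Disc(y₀)=0} e(⟨f', y₀⟩/p)` (sums over
`V(𝔽_p)`), and both character sums over these CONES are controlled by the homogeneity identity
`(p − 1) Σ_{y∈A} e(⟨w,y⟩/p) = p·#(A ∩ w^⊥) − #A` and elementary point counts. Everything here is PROVED
(the only definitions are the explicit finite sets `discZero`, `gradZero` and the counting sum `countSol`):

* `disc_liftForm_eq_zero_of_grad` — **`∇Disc(y₀) = 0` over `𝔽_p` forces `Disc(ỹ₀) = 0` in `ℤ/p²ℤ`**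
  (through the Hessian: `4P² = −3a∂_c − b∂_d`, `4R² = −3d∂_b − c∂_a`, `Q² − 4PR = −3 Disc`);
* `countSol_of_ne_zero`, `countSol_zero`, `fibreSum_smul_p`, `sum_psiLocal_mul_eMod_smul_p` — the fibre sums
  for `p f'` and the displayed formula;
* `homog_identity`, `norm_sum_eMod_cone_le` — the homogeneity identity and the cone bound;
* `card_discZero_le` (`≤ 3p³ + p²`), `card_discZero_perp_le` (`≤ 3p² + p` when `w_d ≠ 0`),
  `card_gradZero_le` (`≤ p² + p`), `card_gradZero_perp_le` (`≤ 4p` when `w_d ≠ 0`) — the point counts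
  (at most `3` roots of explicit cubics, Mathlib's `Cubic.card_roots_le`);
* `exists_sl2z_not_dvd_a` — normalisation `p ∤ a` by a shear in `SL₂(ℤ)`;
* **`norm_fourierDual_psiLocal_le_of_isMultiple`** — **`|Ψ̂_{p²}(ι⁻¹ f)| ≤ 9 p⁻³` when `p ∥ f`**.

## References

* M. Bhargava, T. Taniguchi, F. Thorne, *Improved error estimates for the Davenport–Heilbronn theorems*,
  Math. Ann. 389 (2024) = arXiv:2107.12819, §5, Prop. 5.2 [BhargavaTaniguchiThorne2023].
* T. Taniguchi, F. Thorne, *Secondary terms in counting functions for cubic fields*, Duke Math. J. 162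
  (2013), Lemmas 3.3, 4.3 [TaniguchiThorne2013].
-/

noncomputable section

open Complex Finset
open Literature.NumberTheory.CubicFields.BinaryCubic

namespace Literature.NumberTheory.CubicFields

/-! ## Part III — content divisible by `p`: `f = p f'` with `f'` primitive at `p` -/

section Content

variable {p : ℕ} [hp : Fact p.Prime]

/-! ### `∇Disc ≡ 0 (mod p)` forces `p² ∣ Disc` (through the Hessian) -/

/-- `4(3ac − b²)² = −3a ∂_c Disc − b ∂_d Disc`. [folklore] -/
theorem BinaryCubic.four_mul_hessP_sq {R : Type*} [CommRing R] (y : BinaryCubic R) :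
    4 * (3 * y.a * y.c - y.b ^ 2) ^ 2 = -3 * y.a * y.discDc - y.b * y.discDd := by
  simp only [discDc, discDd]; ring

/-- `4(3bd − c²)² = −3d ∂_b Disc − c ∂_a Disc` (the mirror identity). [folklore] -/
theorem BinaryCubic.four_mul_hessR_sq {R : Type*} [CommRing R] (y : BinaryCubic R) :
    4 * (3 * y.b * y.d - y.c ^ 2) ^ 2 = -3 * y.d * y.discDb - y.c * y.discDa := by
  simp only [discDb, discDa]; ring

/-- In `ℤ/p²ℤ`: two multiples of `p` have product `0`. [folklore] -/
theorem mul_eq_zero_of_redP {x x' : ZMod (p ^ 2)} (hx : redP x = 0) (hx' : redP x' = 0) : x * x' = 0 := by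
  rw [eq_p_mul_liftP_divP hx, eq_p_mul_liftP_divP hx']
  have := natCast_p_sq (p := p)
  linear_combination (liftP (divP x) * liftP (divP x')) * this

/-- In `𝔽_p`, `p ≥ 5`: `4x² = 0 ⇒ x = 0`. [folklore] -/
theorem eq_zero_of_four_mul_sq (hp5 : 5 ≤ p) {x : ZMod p} (h : 4 * x ^ 2 = 0) : x = 0 := by
  rcases mul_eq_zero.mp h with h4 | h2
  · exact absurd h4 (four_ne_zero_zmod hp5)
  · exact pow_eq_zero_iff (n := 2) (by norm_num) |>.mp h2

/-- **`∇Disc(y₀) = 0` over `𝔽_p` forces `Disc(ỹ₀) = 0` in `ℤ/p²ℤ`** (`p ≥ 5`): the Hessian coefficients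
`P = b² − 3ac`, `R = c² − 3bd` of the lift are `≡ 0 (mod p)` (`4P²`, `4R²` are combinations of the partials),
so `Q² = −3 Disc + 4PR = −3 Disc` in `ℤ/p²`; and `Disc ≡ 0` (Euler) gives `Q ≡ 0`, `Q² = 0`, `Disc = 0`. [folklore] -/
theorem disc_liftForm_eq_zero_of_grad (hp5 : 5 ≤ p) {y₀ : BinaryCubic (ZMod p)} (hg : grad y₀ = 0) :
    (liftForm y₀).disc = 0 := by
  set Y := liftForm y₀ with hY
  have hred : Y.map redP = y₀ := liftForm_map_redP y₀
  have hgY : (grad Y).map redP = 0 := by rw [← grad_map, hred, hg]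
  have hDa : redP Y.discDa = 0 := by simpa [grad, BinaryCubic.map] using congrArg BinaryCubic.a hgY
  have hDb : redP Y.discDb = 0 := by simpa [grad, BinaryCubic.map] using congrArg BinaryCubic.b hgY
  have hDc : redP Y.discDc = 0 := by simpa [grad, BinaryCubic.map] using congrArg BinaryCubic.c hgY
  have hDd : redP Y.discDd = 0 := by simpa [grad, BinaryCubic.map] using congrArg BinaryCubic.d hgY
  -- the Hessian coefficients are `≡ 0 (mod p)`
  have hP : redP (Y.b ^ 2 - 3 * Y.a * Y.c) = 0 := by
    have h := congrArg redP (BinaryCubic.four_mul_hessP_sq Y)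
    simp only [map_sub, map_mul, map_pow, map_ofNat, hDc, hDd, mul_zero, sub_zero] at h
    have h' := eq_zero_of_four_mul_sq hp5 h
    simp only [map_sub, map_mul, map_pow, map_ofNat]
    linear_combination -h'
  have hR : redP (Y.c ^ 2 - 3 * Y.b * Y.d) = 0 := by
    have h := congrArg redP (BinaryCubic.four_mul_hessR_sq Y)
    simp only [map_sub, map_mul, map_pow, map_ofNat, hDb, hDa, mul_zero, sub_zero] at h
    have h' := eq_zero_of_four_mul_sq hp5 h
    simp only [map_sub, map_mul, map_pow, map_ofNat]
    linear_combination -h'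
  -- `Q² = −3 Disc` in `ℤ/p²`
  have hQ2 : (Y.b * Y.c - 9 * Y.a * Y.d) ^ 2 = -3 * Y.disc := by
    have h := hessQ_sq_sub Y
    have hPR : (Y.b ^ 2 - 3 * Y.a * Y.c) * (Y.c ^ 2 - 3 * Y.b * Y.d) = 0 := mul_eq_zero_of_redP hP hR
    linear_combination h + 4 * hPR
  -- `Disc ≡ 0 (mod p)` by Euler, hence `Q ≡ 0`, `Q² = 0`, `−3 Disc = 0`
  have hD0 : y₀.disc = 0 := by
    have e := dot_grad_self y₀
    rw [hg, show dot (0 : BinaryCubic (ZMod p)) y₀ = 0 by simp [dot]] at e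
    rcases mul_eq_zero.mp e.symm with h4 | h
    · exact absurd h4 (four_ne_zero_zmod hp5)
    · exact h
  have hQ : redP (Y.b * Y.c - 9 * Y.a * Y.d) = 0 := by
    have h := congrArg redP hQ2
    rw [map_pow, map_mul, ← disc_map, hred, hD0, mul_zero] at h
    exact pow_eq_zero_iff (n := 2) (by norm_num) |>.mp h
  have h3 : IsUnit ((3 : ℕ) : ZMod (p ^ 2)) := by
    refine ZMod.isUnit_prime_of_not_dvd Nat.prime_three fun h => ?_
    have := (Nat.prime_dvd_prime_iff_eq Nat.prime_three hp.out).mp (Nat.prime_three.dvd_of_dvd_pow h)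
    omega
  have hfin : -3 * Y.disc = 0 := by
    rw [← hQ2, pow_two (Y.b * Y.c - 9 * Y.a * Y.d)]; exact mul_eq_zero_of_redP hQ hQ
  rw [neg_mul, neg_eq_zero] at hfin
  exact (h3.mul_right_eq_zero).mp (by exact_mod_cast hfin)

/-! ### Counting solutions of `c + ⟨L, z⟩ = 0` -/

/-- `#{z ∈ V(𝔽_p) : c + ⟨L, z⟩ = 0}` as a complex number. [folklore] -/
def countSol (L : BinaryCubic (ZMod p)) (c : ZMod p) : ℂ :=
  ∑ z : BinaryCubic (ZMod p), if c + dot L z = 0 then 1 else 0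

/-- `dot` is linear in the second variable under scaling. [folklore] -/
theorem dot_smul_right (L : BinaryCubic (ZMod p)) (s : ZMod p) (v : BinaryCubic (ZMod p)) :
    dot L (s • v) = s * dot L v := by
  simp only [dot, smul_a, smul_b, smul_c, smul_d]; ring

/-- A nonzero functional takes the value `1`. [folklore] -/
theorem exists_dot_eq_one {L : BinaryCubic (ZMod p)} (hL : ¬ (L.a = 0 ∧ L.b = 0 ∧ L.c = 0 ∧ L.d = 0)) :
    ∃ v : BinaryCubic (ZMod p), dot L v = 1 := by
  by_cases ha : L.a = 0
  · by_cases hb : L.b = 0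
    · by_cases hc : L.c = 0
      · have hd : L.d ≠ 0 := fun hd => hL ⟨ha, hb, hc, hd⟩
        exact ⟨⟨0, 0, 0, L.d⁻¹⟩, by simp [dot, hd]⟩
      · exact ⟨⟨0, 0, L.c⁻¹, 0⟩, by simp [dot, hc]⟩
    · exact ⟨⟨0, L.b⁻¹, 0, 0⟩, by simp [dot, hb]⟩
  · exact ⟨⟨L.a⁻¹, 0, 0, 0⟩, by simp [dot, ha]⟩

/-- All level sets of a nonzero functional have the same number of points (shift along `v` with `⟨L, v⟩ = 1`). [folklore] -/
theorem countSol_eq_countSol {L : BinaryCubic (ZMod p)} (hL : ¬ (L.a = 0 ∧ L.b = 0 ∧ L.c = 0 ∧ L.d = 0))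
    (c c' : ZMod p) : countSol L c' = countSol L c := by
  obtain ⟨v, hv⟩ := exists_dot_eq_one hL
  unfold countSol
  conv_lhs => rw [← (addShift ((c - c') • v)).sum_comp]
  refine Finset.sum_congr rfl fun z _ => ?_
  rw [dot_addShift, dot_smul_right, hv, mul_one, show c' + (dot L z + (c - c')) = c + dot L z by ring]

/-- `Σ_c #{z : c + ⟨L, z⟩ = 0} = p⁴` (every `z` lies on exactly one level set). [folklore] -/
theorem sum_countSol (L : BinaryCubic (ZMod p)) : ∑ c : ZMod p, countSol L c = (p : ℂ) ^ 4 := by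
  unfold countSol
  rw [Finset.sum_comm]
  have : ∀ z : BinaryCubic (ZMod p), (∑ c : ZMod p, if c + dot L z = 0 then (1 : ℂ) else 0) = 1 := by
    intro z
    rw [Finset.sum_eq_single (-dot L z) (fun c _ hc => if_neg (fun h => hc (by linear_combination h)))
      (fun h => absurd (Finset.mem_univ _) h), if_pos (by ring)]
  rw [Finset.sum_congr rfl (fun z _ => this z), Finset.sum_const, Finset.card_univ, BinaryCubic.card_eq, ZMod.card]
  simp

/-- **`#{z : c + ⟨L, z⟩ = 0} = p³` for `L ≠ 0`.** [folklore] -/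
theorem countSol_of_ne_zero {L : BinaryCubic (ZMod p)} (hL : ¬ (L.a = 0 ∧ L.b = 0 ∧ L.c = 0 ∧ L.d = 0)) (c : ZMod p) :
    countSol L c = (p : ℂ) ^ 3 := by
  have hpC : (p : ℂ) ≠ 0 := Nat.cast_ne_zero.mpr hp.out.ne_zero
  have h := sum_countSol L
  rw [Finset.sum_congr rfl (fun c' _ => countSol_eq_countSol hL c c'), Finset.sum_const, Finset.card_univ, ZMod.card,
    nsmul_eq_mul] at h
  have : (p : ℂ) * (countSol L c - (p : ℂ) ^ 3) = 0 := by rw [mul_sub, h]; ring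
  rcases mul_eq_zero.mp this with h0 | h0
  · exact absurd h0 hpC
  · exact sub_eq_zero.mp h0

/-- `#{z : c + ⟨0, z⟩ = 0} = p⁴ [c = 0]`. [folklore] -/
theorem countSol_zero (c : ZMod p) : countSol (0 : BinaryCubic (ZMod p)) c = if c = 0 then (p : ℂ) ^ 4 else 0 := by
  unfold countSol
  simp only [dot, zero_a, zero_b, zero_c, zero_d, zero_mul, add_zero]
  split_ifs with hc
  · rw [Finset.sum_const, Finset.card_univ, BinaryCubic.card_eq, ZMod.card]; simp
  · simp

/-! ### The fibre sums for `f = p f'` and the formula `p⁸ Ψ̂ = p³ Σ_{Disc=0} e + (p⁴ − p³) Σ_{∇Disc=0} e` -/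

/-- The dual vector of `p f'` vanishes mod `p`. [folklore] -/
theorem dualVec_smul_eq_zero {f' : BinaryCubic ℤ} (hf' : IsDualForm f') : dualVec p ((p : ℤ) • f') = 0 := by
  obtain ⟨hb, hc⟩ := hf'
  refine BinaryCubic.ext ?_ ?_ ?_ ?_ <;>
    simp only [dualVec, smul_a, smul_b, smul_c, smul_d, zero_a, zero_b, zero_c, zero_d, neg_eq_zero,
      ZMod.intCast_zmod_eq_zero_iff_dvd]
  · exact dvd_mul_right _ _
  · rw [Int.mul_ediv_assoc _ hc]; exact dvd_mul_right _ _
  · rw [Int.mul_ediv_assoc _ hb]; exact dvd_mul_right _ _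
  · exact dvd_mul_right _ _

omit hp in
/-- `⟨p f', y⟩ = p ⟨f', y⟩` in `ℤ/p²ℤ`. [folklore] -/
theorem dualPairing_smul_p {f' : BinaryCubic ℤ} (hf' : IsDualForm f') (y : BinaryCubic (ZMod (p ^ 2))) :
    dualPairing ((p : ℤ) • f') y = (p : ZMod (p ^ 2)) * dualPairing f' y := by
  obtain ⟨hb, hc⟩ := hf'
  simp only [dualPairing, smul_a, smul_b, smul_c, smul_d, Int.mul_ediv_assoc _ hc, Int.mul_ediv_assoc _ hb]
  push_cast
  ring

/-- **The fibre sum for `f = p f'`**: `Z_f(y₀) = p⁴` if `∇Disc(y₀) = 0`, `p³` if `∇Disc(y₀) ≠ 0 = Disc(y₀)`,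
`0` if `Disc(y₀) ≠ 0`. [folklore] -/
theorem fibreSum_smul_p (hp5 : 5 ≤ p) {f' : BinaryCubic ℤ} (hf' : IsDualForm f') (y₀ : BinaryCubic (ZMod p)) :
    fibreSum ((p : ℤ) • f') y₀ =
      if grad y₀ = 0 then (p : ℂ) ^ 4 else if y₀.disc = 0 then (p : ℂ) ^ 3 else 0 := by
  have hcount : ∀ c, hyperSum (dualVec p ((p : ℤ) • f')) (grad y₀) c = countSol (grad y₀) c := by
    intro c
    rw [dualVec_smul_eq_zero hf', hyperSum, countSol]
    refine Finset.sum_congr rfl fun z _ => ?_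
    simp [dot]
  unfold fibreSum
  by_cases hg : grad y₀ = 0
  · have hD0 : y₀.disc = 0 := by
      have e := dot_grad_self y₀
      rw [hg, show dot (0 : BinaryCubic (ZMod p)) y₀ = 0 by simp [dot]] at e
      rcases mul_eq_zero.mp e.symm with h4 | h
      · exact absurd h4 (four_ne_zero_zmod hp5)
      · exact h
    rw [if_pos hD0, if_pos hg, hcount, hg, countSol_zero, disc_liftForm_eq_zero_of_grad hp5 hg, divP_zero, if_pos rfl]
  · rw [if_neg hg]
    by_cases hD0 : y₀.disc = 0
    · rw [if_pos hD0, if_pos hD0, hcount, countSol_of_ne_zero]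
      intro h
      exact hg (BinaryCubic.ext h.1 h.2.1 h.2.2.1 h.2.2.2)
    · rw [if_neg hD0, if_neg hD0]

variable (p) in
/-- The zero locus of `Disc` in `V(𝔽_p)`. [folklore] -/
def discZero : Finset (BinaryCubic (ZMod p)) := Finset.univ.filter fun y => y.disc = 0

variable (p) in
/-- The common zero locus of `∇Disc` in `V(𝔽_p)` (the cone of cubes `λℓ³`). [folklore] -/
def gradZero : Finset (BinaryCubic (ZMod p)) := Finset.univ.filter fun y => grad y = 0

/-- **`Σ_y Ψ_{p²}(y) e(⟨p f', y⟩/p²) = p³ Σ_{Disc(y₀)=0} e(⟨f', y₀⟩/p) + (p⁴ − p³) Σ_{∇Disc(y₀)=0} e(⟨f', y₀⟩/p)`.** [folklore] -/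
theorem sum_psiLocal_mul_eMod_smul_p (hp5 : 5 ≤ p) {f' : BinaryCubic ℤ} (hf' : IsDualForm f') :
    ∑ y : BinaryCubic (ZMod (p ^ 2)), psiLocal p y * eMod (dualPairing ((p : ℤ) • f') y) =
      (p : ℂ) ^ 3 * ∑ y₀ ∈ discZero p, eMod (dot (dualVec p f') y₀) +
        ((p : ℂ) ^ 4 - (p : ℂ) ^ 3) * ∑ y₀ ∈ gradZero p, eMod (dot (dualVec p f') y₀) := by
  rw [sum_psiLocal_mul_eMod, discZero, gradZero, Finset.sum_filter, Finset.sum_filter, Finset.mul_sum, Finset.mul_sum,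
    ← Finset.sum_add_distrib]
  refine Finset.sum_congr rfl fun y₀ _ => ?_
  have he : eMod (dualPairing ((p : ℤ) • f') (liftForm y₀)) = eMod (dot (dualVec p f') y₀) := by
    rw [dualPairing_smul_p hf', eMod_p_mul, redP_dualPairing, liftForm_map_redP, dualPairing_eq_dot]
  rw [he, fibreSum_smul_p hp5 hf']
  by_cases hg : grad y₀ = 0
  · have hD0 : y₀.disc = 0 := by
      have e := dot_grad_self y₀
      rw [hg, show dot (0 : BinaryCubic (ZMod p)) y₀ = 0 by simp [dot]] at e
      rcases mul_eq_zero.mp e.symm with h4 | h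
      · exact absurd h4 (four_ne_zero_zmod hp5)
      · exact h
    rw [if_pos hg, if_pos hD0, if_pos hg]; ring
  · rw [if_neg hg, if_neg hg]
    by_cases hD0 : y₀.disc = 0
    · rw [if_pos hD0, if_pos hD0]; ring
    · rw [if_neg hD0, if_neg hD0]; ring

end Content

section ContentBounds

variable {p : ℕ} [hp : Fact p.Prime]

/-! ### The homogeneity trick: character sums over cones -/

/-- Scaling `y ↦ s·y` (`s ≠ 0`) permutes a cone `A`, so `Σ_{y∈A} e(⟨w, sy⟩/p) = Σ_{y∈A} e(⟨w, y⟩/p)`. [folklore] -/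
theorem sum_eMod_dot_smul {A : Finset (BinaryCubic (ZMod p))} (hA : ∀ s : ZMod p, s ≠ 0 → ∀ y ∈ A, s • y ∈ A)
    {s : ZMod p} (hs : s ≠ 0) (w : BinaryCubic (ZMod p)) :
    ∑ y ∈ A, eMod (dot w (s • y)) = ∑ y ∈ A, eMod (dot w y) := by
  refine Finset.sum_nbij' (fun y => s • y) (fun y => s⁻¹ • y) (fun y hy => hA s hs y hy)
    (fun y hy => hA s⁻¹ (inv_ne_zero hs) y hy) (fun y _ => ?_) (fun y _ => ?_) (fun y _ => rfl)
  · rw [smul_smul, inv_mul_cancel₀ hs, one_smul]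
  · rw [smul_smul, mul_inv_cancel₀ hs, one_smul]

/-- **The homogeneity identity**: for a cone `A ⊆ V(𝔽_p)` (stable under `y ↦ sy`, `s ≠ 0`),
`(p − 1) Σ_{y∈A} e(⟨w, y⟩/p) = p · #{y ∈ A : ⟨w, y⟩ = 0} − #A` (average over `s ∈ 𝔽_p^×` and use
`Σ_{s≠0} e(st/p) = p[t=0] − 1`). [folklore] -/
theorem homog_identity {A : Finset (BinaryCubic (ZMod p))} (hA : ∀ s : ZMod p, s ≠ 0 → ∀ y ∈ A, s • y ∈ A)
    (w : BinaryCubic (ZMod p)) :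
    ((p : ℂ) - 1) * ∑ y ∈ A, eMod (dot w y) =
      (p : ℂ) * (((A.filter fun y => dot w y = 0).card : ℕ) : ℂ) - ((A.card : ℕ) : ℂ) := by
  have hp1 : 1 ≤ p := hp.out.one_lt.le
  -- `(p − 1) S = Σ_{s ≠ 0} Σ_{y ∈ A} e(⟨w, sy⟩)`
  have h1 : ((p : ℂ) - 1) * ∑ y ∈ A, eMod (dot w y) =
      ∑ s ∈ (Finset.univ : Finset (ZMod p)).erase 0, ∑ y ∈ A, eMod (dot w (s • y)) := by
    rw [Finset.sum_congr rfl (fun s hs => sum_eMod_dot_smul hA (Finset.ne_of_mem_erase hs) w), Finset.sum_const,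
      Finset.card_erase_of_mem (Finset.mem_univ _), Finset.card_univ, ZMod.card, nsmul_eq_mul, Nat.cast_sub hp1,
      Nat.cast_one]
  rw [h1, Finset.sum_comm]
  -- inner sums: `Σ_{s ≠ 0} e(s t) = p[t = 0] − 1`
  have h2 : ∀ y : BinaryCubic (ZMod p), (∑ s ∈ (Finset.univ : Finset (ZMod p)).erase 0, eMod (dot w (s • y))) =
      (if dot w y = 0 then (p : ℂ) else 0) - 1 := by
    intro y
    rw [Finset.sum_erase_eq_sub (Finset.mem_univ _), ← sum_eMod_mul (dot w y)]
    simp only [dot_smul_right, zero_mul, eMod_zero]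
    congr 1
    exact Finset.sum_congr rfl fun s _ => by rw [mul_comm]
  rw [Finset.sum_congr rfl (fun y _ => h2 y), Finset.sum_sub_distrib, Finset.sum_const, nsmul_eq_mul, mul_one,
    Finset.card_filter, Nat.cast_sum, Finset.mul_sum]
  congr 1
  refine Finset.sum_congr rfl fun y _ => ?_
  split_ifs <;> simp

/-- `|a − b| ≤ max a b` for `a, b ≥ 0`. [folklore] -/
theorem abs_sub_le_max {a b : ℝ} (ha : 0 ≤ a) (hb : 0 ≤ b) : |a - b| ≤ max a b := by
  rcases le_total a b with h | h
  · rw [abs_of_nonpos (by linarith)]; exact le_trans (by linarith) (le_max_right a b)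
  · rw [abs_of_nonneg (by linarith)]; exact le_trans (by linarith) (le_max_left a b)

/-- **The cone bound**: `|Σ_{y∈A} e(⟨w, y⟩/p)| ≤ max(p·N_w, N)/(p − 1)` for a cone `A` with `#A ≤ N`,
`#{y ∈ A : ⟨w,y⟩ = 0} ≤ N_w`. [folklore] -/
theorem norm_sum_eMod_cone_le {A : Finset (BinaryCubic (ZMod p))} (hA : ∀ s : ZMod p, s ≠ 0 → ∀ y ∈ A, s • y ∈ A)
    (w : BinaryCubic (ZMod p)) {B Bw : ℝ} (hB : (A.card : ℝ) ≤ B)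
    (hBw : (((A.filter fun y => dot w y = 0).card : ℕ) : ℝ) ≤ Bw) :
    ‖∑ y ∈ A, eMod (dot w y)‖ ≤ max ((p : ℝ) * Bw) B / ((p : ℝ) - 1) := by
  have hp1 : (1 : ℝ) < p := by exact_mod_cast hp.out.one_lt
  have hp0 : (0 : ℝ) ≤ p := by linarith
  have hpm : (0 : ℝ) < (p : ℝ) - 1 := by linarith
  have hpmC : ((p : ℂ) - 1) ≠ 0 := by
    rw [show ((p : ℂ) - 1) = (((p : ℝ) - 1 : ℝ) : ℂ) by push_cast; rfl]
    exact_mod_cast hpm.ne'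
  set Nw := ((A.filter fun y => dot w y = 0).card : ℕ)
  set N := A.card
  have hid := homog_identity hA w
  have hS : ∑ y ∈ A, eMod (dot w y) = ((((p : ℝ) * Nw - N) / ((p : ℝ) - 1) : ℝ) : ℂ) := by
    rw [Complex.ofReal_div, eq_div_iff (by exact_mod_cast hpm.ne'), mul_comm]
    convert hid using 1 <;> push_cast <;> ring
  rw [hS, Complex.norm_real, Real.norm_eq_abs, abs_div, abs_of_pos hpm, div_le_div_iff_of_pos_right hpm]
  calc |(p : ℝ) * Nw - N| ≤ max ((p : ℝ) * Nw) N := abs_sub_le_max (by positivity) (by positivity)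
    _ ≤ max ((p : ℝ) * Bw) B := max_le_max (mul_le_mul_of_nonneg_left hBw hp0) hB

/-- `discZero` is a cone. [folklore] -/
theorem smul_mem_discZero (s : ZMod p) {y : BinaryCubic (ZMod p)} (hy : y ∈ discZero p) :
    s • y ∈ discZero p := by
  simp only [discZero, Finset.mem_filter, Finset.mem_univ, true_and] at hy ⊢
  rw [disc_smul, hy, mul_zero]

/-- `∇Disc(s y) = s³ ∇Disc(y)`. [folklore] -/
theorem grad_smul (s : ZMod p) (y : BinaryCubic (ZMod p)) : grad (s • y) = (s ^ 3) • grad y := by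
  ext <;> simp only [grad, discDa, discDb, discDc, discDd, smul_a, smul_b, smul_c, smul_d] <;> ring

/-- `gradZero` is a cone. [folklore] -/
theorem smul_mem_gradZero (s : ZMod p) {y : BinaryCubic (ZMod p)} (hy : y ∈ gradZero p) :
    s • y ∈ gradZero p := by
  simp only [gradZero, Finset.mem_filter, Finset.mem_univ, true_and] at hy ⊢
  rw [grad_smul, hy]; ext <;> simp

/-! ### Root counting for explicit cubics -/

/-- A cubic equation with a nonzero coefficient has at most `3` solutions in `𝔽_p`. [folklore] -/
theorem card_filter_cubic_le {K : Cubic (ZMod p)} (hK : K.toPoly ≠ 0) :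
    (Finset.univ.filter fun x : ZMod p => K.a * x ^ 3 + K.b * x ^ 2 + K.c * x + K.d = 0).card ≤ 3 := by
  classical
  refine le_trans (Finset.card_le_card fun x hx => ?_) (Cubic.card_roots_le (P := K))
  rw [Finset.mem_filter] at hx
  rw [Multiset.mem_toFinset]
  exact (Cubic.mem_roots_iff hK x).mpr hx.2

/-- Any subset of `𝔽_p` has at most `p` elements. [folklore] -/
theorem card_filter_le_p (P : ZMod p → Prop) [DecidablePred P] : (Finset.univ.filter P).card ≤ p := by
  refine le_trans (Finset.card_filter_le _ _) ?_
  rw [Finset.card_univ, ZMod.card]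

/-- `27 ≠ 0` and `54 ≠ 0`, `3 ≠ 0`, `2 ≠ 0` in `𝔽_p` for `p ≥ 5`. [folklore] -/
theorem natCast_ne_zero_of_lt {n : ℕ} (h : ∀ q : ℕ, q.Prime → q ∣ n → q < 5) (hp5 : 5 ≤ p) :
    ((n : ℕ) : ZMod p) ≠ 0 := by
  rw [Ne, ZMod.natCast_eq_zero_iff]
  intro hd
  have := h p hp.out hd
  omega

/-- `54 ≠ 0` in `𝔽_p`, `p ≥ 5`. [folklore] -/
theorem fiftyfour_ne_zero (hp5 : 5 ≤ p) : (54 : ZMod p) ≠ 0 := by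
  have h2 : (2 : ZMod p) ≠ 0 := by
    intro h
    have h' : ((2 : ℕ) : ZMod p) = 0 := by exact_mod_cast h
    rw [ZMod.natCast_eq_zero_iff] at h'
    have := Nat.le_of_dvd (by norm_num) h'
    omega
  have := mul_ne_zero h2 (Literature.NumberTheory.EllipticCurves.BSZLemma18.twentyseven_ne_zero_zmod hp5)
  convert this using 1; norm_num

/-- `3 ≠ 0` in `𝔽_p`, `p ≥ 5`. [folklore] -/
theorem three_ne_zero_zmod (hp5 : 5 ≤ p) : (3 : ZMod p) ≠ 0 := by
  intro h
  have h' : ((3 : ℕ) : ZMod p) = 0 := by exact_mod_cast h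
  rw [ZMod.natCast_eq_zero_iff] at h'
  have := Nat.le_of_dvd (by norm_num) h'
  omega

/-! ### `#{Disc = 0} ≤ 3p³ + p²` -/

/-- `V(R) ≃ R⁴` in the order `(b, c, d, a)`. [folklore] -/
def equivProdBCDA {R : Type*} : BinaryCubic R ≃ R × R × R × R where
  toFun f := (f.b, f.c, f.d, f.a)
  invFun v := ⟨v.2.2.2, v.1, v.2.1, v.2.2.1⟩
  left_inv := fun ⟨_, _, _, _⟩ => rfl
  right_inv := fun ⟨_, _, _, _⟩ => rfl

/-- `Σ_{z ∈ V(R)} F(z_a, z_b, z_c, z_d) = Σ_b Σ_c Σ_d Σ_a F(a, b, c, d)`. [folklore] -/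
theorem sum_binaryCubic_bcda {R M : Type*} [Fintype R] [AddCommMonoid M] (F : R → R → R → R → M) :
    ∑ z : BinaryCubic R, F z.a z.b z.c z.d = ∑ b : R, ∑ c : R, ∑ d : R, ∑ a : R, F a b c d := by
  rw [← equivProdBCDA.symm.sum_comp, Fintype.sum_prod_type, Finset.sum_congr rfl]
  intro b _
  rw [Fintype.sum_prod_type, Finset.sum_congr rfl]
  intro c _
  rw [Fintype.sum_prod_type]
  rfl

/-- `Disc` as a polynomial in `a`: `−27d² a² + (18bcd − 4c³) a + (b²c² − 4b³d)`. [folklore] -/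
theorem disc_eq_cubic_a {R : Type*} [CommRing R] (a b c d : R) :
    (⟨a, b, c, d⟩ : BinaryCubic R).disc = 0 * a ^ 3 + (-27 * d ^ 2) * a ^ 2 + (18 * b * c * d - 4 * c ^ 3) * a
      + (b ^ 2 * c ^ 2 - 4 * b ^ 3 * d) := by
  rw [disc_eq]; ring

/-- For fixed `(b, c, d)`: at most `3` values of `a` with `Disc = 0`, unless `c = d = 0`. [folklore] -/
theorem card_filter_disc_a_le (hp5 : 5 ≤ p) (b c d : ZMod p) :
    (Finset.univ.filter fun a : ZMod p => (⟨a, b, c, d⟩ : BinaryCubic (ZMod p)).disc = 0).card ≤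
      3 + (if c = 0 ∧ d = 0 then p else 0) := by
  by_cases hcd : c = 0 ∧ d = 0
  · rw [if_pos hcd]; exact le_trans (card_filter_le_p _) (Nat.le_add_left _ _)
  · rw [if_neg hcd, add_zero]
    set K : Cubic (ZMod p) := ⟨0, -27 * d ^ 2, 18 * b * c * d - 4 * c ^ 3, b ^ 2 * c ^ 2 - 4 * b ^ 3 * d⟩
    have hK : K.toPoly ≠ 0 := by
      by_cases hd : d = 0
      · have hc : c ≠ 0 := fun hc => hcd ⟨hc, hd⟩
        refine Cubic.ne_zero_of_c_ne_zero ?_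
        show 18 * b * c * d - 4 * c ^ 3 ≠ 0
        rw [hd, mul_zero, zero_sub, neg_ne_zero]
        exact mul_ne_zero (four_ne_zero_zmod hp5) (pow_ne_zero 3 hc)
      · refine Cubic.ne_zero_of_b_ne_zero ?_
        show -27 * d ^ 2 ≠ 0
        exact mul_ne_zero (neg_ne_zero.mpr (Literature.NumberTheory.EllipticCurves.BSZLemma18.twentyseven_ne_zero_zmod hp5)) (pow_ne_zero 2 hd)
    refine le_trans (le_of_eq ?_) (card_filter_cubic_le hK)
    congr 1
    refine Finset.filter_congr fun a _ => ?_
    rw [disc_eq_cubic_a]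

/-- **`#{y ∈ V(𝔽_p) : Disc(y) = 0} ≤ 3p³ + p²`** (`p ≥ 5`). [folklore] -/
theorem card_discZero_le (hp5 : 5 ≤ p) : (discZero p).card ≤ 3 * p ^ 3 + p ^ 2 := by
  rw [discZero, Finset.card_filter,
    show (∑ y : BinaryCubic (ZMod p), if y.disc = 0 then 1 else 0)
      = ∑ y : BinaryCubic (ZMod p), (if (⟨y.a, y.b, y.c, y.d⟩ : BinaryCubic (ZMod p)).disc = 0 then 1 else 0) from
      Finset.sum_congr rfl (fun y _ => by cases y; rfl),
    sum_binaryCubic_bcda (fun a b c d => if (⟨a, b, c, d⟩ : BinaryCubic (ZMod p)).disc = 0 then 1 else 0)]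
  have inner : ∀ b c d : ZMod p, (∑ a : ZMod p, if (⟨a, b, c, d⟩ : BinaryCubic (ZMod p)).disc = 0 then 1 else 0)
      ≤ 3 + (if c = 0 ∧ d = 0 then p else 0) := by
    intro b c d
    rw [← Finset.card_filter]
    exact card_filter_disc_a_le hp5 b c d
  calc (∑ b : ZMod p, ∑ c : ZMod p, ∑ d : ZMod p, ∑ a : ZMod p,
          if (⟨a, b, c, d⟩ : BinaryCubic (ZMod p)).disc = 0 then 1 else 0)
      ≤ ∑ _b : ZMod p, ∑ c : ZMod p, ∑ d : ZMod p, (3 + (if c = 0 ∧ d = 0 then p else 0)) :=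
        Finset.sum_le_sum fun b _ => Finset.sum_le_sum fun c _ => Finset.sum_le_sum fun d _ => inner b c d
    _ = 3 * p ^ 3 + p ^ 2 := by
        have h1 : ∀ c : ZMod p, (∑ d : ZMod p, (3 + (if c = 0 ∧ d = 0 then p else 0))) = 3 * p + (if c = 0 then p else 0) := by
          intro c
          rw [Finset.sum_add_distrib, Finset.sum_const, Finset.card_univ, ZMod.card, smul_eq_mul, mul_comm]
          congr 1
          by_cases hc : c = 0
          · simp only [hc, true_and, if_true]
            rw [Finset.sum_ite_eq' Finset.univ (0 : ZMod p)]; simp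
          · simp [hc]
        simp_rw [h1]
        rw [Finset.sum_congr rfl (fun b _ => by rw [Finset.sum_add_distrib, Finset.sum_const, Finset.card_univ, ZMod.card,
          smul_eq_mul, Finset.sum_ite_eq' Finset.univ (0 : ZMod p), if_pos (Finset.mem_univ _)]),
          Finset.sum_const, Finset.card_univ, ZMod.card, smul_eq_mul]
        ring

/-! ### `#{Disc = 0, ⟨w, y⟩ = 0} ≤ 3p² + p` when `w_d ≠ 0` -/

/-- `Disc(a, b, c, α₀ + α₁ c)` as a cubic in `c` (leading coefficient `−4a`). [folklore] -/
theorem disc_eq_cubic_c {R : Type*} [CommRing R] (a b c α₀ α₁ : R) :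
    (⟨a, b, c, α₀ + α₁ * c⟩ : BinaryCubic R).disc =
      (-4 * a) * c ^ 3 + (b ^ 2 - 27 * a ^ 2 * α₁ ^ 2 + 18 * a * b * α₁) * c ^ 2
        + (-4 * b ^ 3 * α₁ - 54 * a ^ 2 * α₀ * α₁ + 18 * a * b * α₀) * c + (-4 * b ^ 3 * α₀ - 27 * a ^ 2 * α₀ ^ 2) := by
  rw [disc_eq]; ring

/-- For fixed `(a, b)` and `d` the affine function `α₀ + α₁c` of `c`: at most `3` values of `c` with `Disc = 0`,
unless `a = b = 0`. [folklore] -/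
theorem card_filter_disc_c_le (hp5 : 5 ≤ p) (a b α₀ α₁ : ZMod p) :
    (Finset.univ.filter fun c : ZMod p => (⟨a, b, c, α₀ + α₁ * c⟩ : BinaryCubic (ZMod p)).disc = 0).card ≤
      3 + (if a = 0 ∧ b = 0 then p else 0) := by
  by_cases hab : a = 0 ∧ b = 0
  · rw [if_pos hab]; exact le_trans (card_filter_le_p _) (Nat.le_add_left _ _)
  · rw [if_neg hab, add_zero]
    set K : Cubic (ZMod p) := ⟨-4 * a, b ^ 2 - 27 * a ^ 2 * α₁ ^ 2 + 18 * a * b * α₁,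
      -4 * b ^ 3 * α₁ - 54 * a ^ 2 * α₀ * α₁ + 18 * a * b * α₀, -4 * b ^ 3 * α₀ - 27 * a ^ 2 * α₀ ^ 2⟩
    have hK : K.toPoly ≠ 0 := by
      by_cases ha : a = 0
      · have hb : b ≠ 0 := fun hb => hab ⟨ha, hb⟩
        refine Cubic.ne_zero_of_b_ne_zero ?_
        show b ^ 2 - 27 * a ^ 2 * α₁ ^ 2 + 18 * a * b * α₁ ≠ 0
        rw [ha]; simpa using pow_ne_zero 2 hb
      · refine Cubic.ne_zero_of_a_ne_zero ?_
        show -4 * a ≠ 0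
        exact mul_ne_zero (neg_ne_zero.mpr (four_ne_zero_zmod hp5)) ha
    refine le_trans (le_of_eq ?_) (card_filter_cubic_le hK)
    congr 1
    refine Finset.filter_congr fun c _ => ?_
    rw [disc_eq_cubic_c]

/-- **`#{y : Disc(y) = 0, ⟨w, y⟩ = 0} ≤ 3p² + p`** for `w_d ≠ 0` (solve `y_d` from `⟨w, y⟩ = 0`; for each
`(a, b)` at most `3` values of `c` unless `a = b = 0`). [folklore] -/
theorem card_discZero_perp_le (hp5 : 5 ≤ p) {w : BinaryCubic (ZMod p)} (hw : w.d ≠ 0) :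
    ((discZero p).filter fun y => dot w y = 0).card ≤ 3 * p ^ 2 + p := by
  classical
  -- `y_d = α₀(a,b) + α₁ c` on the hyperplane
  set α₁ : ZMod p := -w.c * w.d⁻¹ with hα₁
  let α₀ : ZMod p → ZMod p → ZMod p := fun a b => -(w.a * a + w.b * b) * w.d⁻¹
  have hsolve : ∀ y : BinaryCubic (ZMod p), dot w y = 0 → y.d = α₀ y.a y.b + α₁ * y.c := by
    intro y hy
    simp only [dot] at hy
    have : y.d = -(w.a * y.a + w.b * y.b + w.c * y.c) * w.d⁻¹ := by
      field_simp
      linear_combination hy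
    rw [this, hα₁]; ring
  let T : Finset (ZMod p × ZMod p × ZMod p) :=
    Finset.univ.filter fun abc => (⟨abc.1, abc.2.1, abc.2.2, α₀ abc.1 abc.2.1 + α₁ * abc.2.2⟩ : BinaryCubic (ZMod p)).disc = 0
  have hmaps : Set.MapsTo (fun y : BinaryCubic (ZMod p) => (y.a, y.b, y.c))
      (((discZero p).filter fun y => dot w y = 0) : Finset _) T := by
    intro y hy
    simp only [Finset.coe_filter, discZero, Finset.mem_filter, Finset.mem_univ, true_and, Set.mem_setOf_eq] at hy
    simp only [T, Finset.coe_filter, Finset.mem_univ, true_and, Set.mem_setOf_eq]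
    have hyeq : y = ⟨y.a, y.b, y.c, α₀ y.a y.b + α₁ * y.c⟩ := BinaryCubic.ext rfl rfl rfl (hsolve y hy.2)
    rw [← hyeq]; exact hy.1
  have hinj : Set.InjOn (fun y : BinaryCubic (ZMod p) => (y.a, y.b, y.c))
      (((discZero p).filter fun y => dot w y = 0) : Finset _) := by
    intro y hy y' hy' h
    simp only [Finset.coe_filter, Set.mem_setOf_eq] at hy hy'
    simp only [Prod.mk.injEq] at h
    obtain ⟨h1, h2, h3⟩ := h
    refine BinaryCubic.ext h1 h2 h3 ?_
    rw [hsolve y hy.2, hsolve y' hy'.2, h1, h2, h3]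
  refine le_trans (Finset.card_le_card_of_injOn _ hmaps hinj) ?_
  -- `#T = Σ_a Σ_b #{c : …} ≤ Σ_a Σ_b (3 + [a = b = 0] p) = 3p² + p`
  have hT : T.card = ∑ a : ZMod p, ∑ b : ZMod p,
      (Finset.univ.filter fun c : ZMod p => (⟨a, b, c, α₀ a b + α₁ * c⟩ : BinaryCubic (ZMod p)).disc = 0).card := by
    simp only [T, Finset.card_filter]
    rw [Fintype.sum_prod_type, Finset.sum_congr rfl]
    intro a _
    rw [Fintype.sum_prod_type]
  rw [hT]
  calc (∑ a : ZMod p, ∑ b : ZMod p,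
        (Finset.univ.filter fun c : ZMod p => (⟨a, b, c, α₀ a b + α₁ * c⟩ : BinaryCubic (ZMod p)).disc = 0).card)
      ≤ ∑ a : ZMod p, ∑ b : ZMod p, (3 + (if a = 0 ∧ b = 0 then p else 0)) :=
        Finset.sum_le_sum fun a _ => Finset.sum_le_sum fun b _ => card_filter_disc_c_le hp5 a b (α₀ a b) α₁
    _ = 3 * p ^ 2 + p := by
        have h1 : ∀ a : ZMod p, (∑ b : ZMod p, (3 + (if a = 0 ∧ b = 0 then p else 0))) = 3 * p + (if a = 0 then p else 0) := by
          intro a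
          rw [Finset.sum_add_distrib, Finset.sum_const, Finset.card_univ, ZMod.card, smul_eq_mul, mul_comm]
          congr 1
          by_cases ha : a = 0
          · simp only [ha, true_and, if_true]
            rw [Finset.sum_ite_eq' Finset.univ (0 : ZMod p)]; simp
          · simp [ha]
        simp_rw [h1]
        rw [Finset.sum_add_distrib, Finset.sum_const, Finset.card_univ, ZMod.card, smul_eq_mul,
          Finset.sum_ite_eq' Finset.univ (0 : ZMod p), if_pos (Finset.mem_univ _)]
        ring

/-! ### `#{∇Disc = 0} ≤ p² + p` and `#{∇Disc = 0, ⟨w, y⟩ = 0} ≤ 4p` -/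

/-- On `∇Disc = 0` with `a = 0`: `b = c = 0`. [folklore] -/
theorem bc_eq_zero_of_gradZero (hp5 : 5 ≤ p) {y : BinaryCubic (ZMod p)} (hy : grad y = 0) (ha : y.a = 0) :
    y.b = 0 ∧ y.c = 0 := by
  have h4 := four_ne_zero_zmod hp5
  have hd : y.discDd = 0 := congrArg BinaryCubic.d hy
  have hda : y.discDa = 0 := congrArg BinaryCubic.a hy
  have hb : y.b = 0 := by
    have : 4 * y.b ^ 3 = 0 := by simp only [discDd, ha] at hd; linear_combination -hd
    exact pow_eq_zero_iff (n := 3) (by norm_num) |>.mp ((mul_eq_zero.mp this).resolve_left h4)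
  have hc : y.c = 0 := by
    have : 4 * y.c ^ 3 = 0 := by simp only [discDa, ha, hb] at hda; linear_combination -hda
    exact pow_eq_zero_iff (n := 3) (by norm_num) |>.mp ((mul_eq_zero.mp this).resolve_left h4)
  exact ⟨hb, hc⟩

/-- On `∇Disc = 0` with `a ≠ 0`: `3ac = b²` and `27a²d = b³` (so `(a, b)` determine the point). [folklore] -/
theorem rel_of_gradZero (hp5 : 5 ≤ p) {y : BinaryCubic (ZMod p)} (hy : grad y = 0) :
    3 * y.a * y.c = y.b ^ 2 ∧ 27 * y.a ^ 2 * y.d = y.b ^ 3 := by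
  have hc : y.discDc = 0 := congrArg BinaryCubic.c hy
  have hd : y.discDd = 0 := congrArg BinaryCubic.d hy
  have h1 : 3 * y.a * y.c = y.b ^ 2 := by
    have h := BinaryCubic.four_mul_hessP_sq y
    rw [hc, hd, mul_zero, mul_zero, sub_zero] at h
    exact sub_eq_zero.mp (eq_zero_of_four_mul_sq hp5 h)
  refine ⟨h1, ?_⟩
  have h2 : (2 : ZMod p) ≠ 0 := by
    intro h
    have h' : ((2 : ℕ) : ZMod p) = 0 := by exact_mod_cast h
    rw [ZMod.natCast_eq_zero_iff] at h'
    have := Nat.le_of_dvd (by norm_num) h'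
    omega
  have : 2 * (27 * y.a ^ 2 * y.d - y.b ^ 3) = 0 := by
    simp only [discDd] at hd
    linear_combination -hd + 6 * y.b * h1
  exact sub_eq_zero.mp ((mul_eq_zero.mp this).resolve_left h2)

/-- Injectivity of `y ↦ (a, b)` on `{∇Disc = 0, a ≠ 0}`. [folklore] -/
theorem injOn_ab_gradZero (hp5 : 5 ≤ p) {y y' : BinaryCubic (ZMod p)} (hy : grad y = 0) (hy' : grad y' = 0)
    (ha : y.a ≠ 0) (h1 : y.a = y'.a) (h2 : y.b = y'.b) : y = y' := by
  obtain ⟨r1, r2⟩ := rel_of_gradZero hp5 hy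
  obtain ⟨r1', r2'⟩ := rel_of_gradZero hp5 hy'
  rw [← h1, ← h2] at r1' r2'
  have h3 := three_ne_zero_zmod hp5
  have h27 := Literature.NumberTheory.EllipticCurves.BSZLemma18.twentyseven_ne_zero_zmod hp5
  refine BinaryCubic.ext h1 h2 ?_ ?_
  · have : 3 * y.a * (y.c - y'.c) = 0 := by linear_combination r1 - r1'
    exact sub_eq_zero.mp ((mul_eq_zero.mp this).resolve_left (mul_ne_zero h3 ha))
  · have : 27 * y.a ^ 2 * (y.d - y'.d) = 0 := by linear_combination r2 - r2'
    exact sub_eq_zero.mp ((mul_eq_zero.mp this).resolve_left (mul_ne_zero h27 (pow_ne_zero 2 ha)))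

/-- `#{y : ∇Disc(y) = 0, a = 0, extra condition} ≤ p` (such `y` are `(0,0,0,d)`). [folklore] -/
theorem card_gradZero_a_eq_zero_le (hp5 : 5 ≤ p) (P : BinaryCubic (ZMod p) → Prop) [DecidablePred P] :
    ((gradZero p).filter fun y => y.a = 0 ∧ P y).card ≤ p := by
  classical
  have hmaps : Set.MapsTo (fun y : BinaryCubic (ZMod p) => y.d) (((gradZero p).filter fun y => y.a = 0 ∧ P y) : Finset _)
      (Finset.univ : Finset (ZMod p)) := fun y _ => Finset.mem_coe.mpr (Finset.mem_univ _)
  have hinj : Set.InjOn (fun y : BinaryCubic (ZMod p) => y.d) (((gradZero p).filter fun y => y.a = 0 ∧ P y) : Finset _) := by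
    intro y hy y' hy' h
    simp only [gradZero, Finset.coe_filter, Finset.mem_filter, Finset.mem_univ, true_and, Set.mem_setOf_eq] at hy hy'
    obtain ⟨hb, hc⟩ := bc_eq_zero_of_gradZero hp5 hy.1 hy.2.1
    obtain ⟨hb', hc'⟩ := bc_eq_zero_of_gradZero hp5 hy'.1 hy'.2.1
    exact BinaryCubic.ext (hy.2.1.trans hy'.2.1.symm) (hb.trans hb'.symm) (hc.trans hc'.symm) h
  refine le_trans (Finset.card_le_card_of_injOn _ hmaps hinj) ?_
  rw [Finset.card_univ, ZMod.card]

/-- **`#{y : ∇Disc(y) = 0} ≤ p² + p`.** [folklore] -/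
theorem card_gradZero_le (hp5 : 5 ≤ p) : (gradZero p).card ≤ p ^ 2 + p := by
  classical
  rw [← Finset.card_filter_add_card_filter_not (fun y : BinaryCubic (ZMod p) => y.a ≠ 0)]
  refine Nat.add_le_add ?_ ?_
  · have hmaps : Set.MapsTo (fun y : BinaryCubic (ZMod p) => (y.a, y.b)) (((gradZero p).filter fun y => y.a ≠ 0) : Finset _)
        (Finset.univ : Finset (ZMod p × ZMod p)) := fun y _ => Finset.mem_coe.mpr (Finset.mem_univ _)
    have hinj : Set.InjOn (fun y : BinaryCubic (ZMod p) => (y.a, y.b)) (((gradZero p).filter fun y => y.a ≠ 0) : Finset _) := by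
      intro y hy y' hy' h
      simp only [gradZero, Finset.coe_filter, Finset.mem_filter, Finset.mem_univ, true_and, Set.mem_setOf_eq] at hy hy'
      simp only [Prod.mk.injEq] at h
      exact injOn_ab_gradZero hp5 hy.1 hy'.1 hy.2 h.1 h.2
    refine le_trans (Finset.card_le_card_of_injOn _ hmaps hinj) ?_
    rw [Finset.card_univ, Fintype.card_prod, ZMod.card, sq]
  · have := card_gradZero_a_eq_zero_le hp5 (fun _ => True)
    refine le_trans (le_of_eq ?_) this
    congr 1
    exact Finset.filter_congr fun y _ => by simp

/-- **`#{y : ∇Disc(y) = 0, ⟨w, y⟩ = 0} ≤ 4p`** for `w_d ≠ 0` (on `a ≠ 0` the points are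
`(a, b, b²/3a, b³/27a²)` and `27a² ⟨w, y⟩ = w_d b³ + 9a w_c b² + 27a² w_b b + 27a³ w_a` is a cubic in `b`). [folklore] -/
theorem card_gradZero_perp_le (hp5 : 5 ≤ p) {w : BinaryCubic (ZMod p)} (hw : w.d ≠ 0) :
    ((gradZero p).filter fun y => dot w y = 0).card ≤ 4 * p := by
  classical
  rw [← Finset.card_filter_add_card_filter_not (fun y : BinaryCubic (ZMod p) => y.a ≠ 0),
    show 4 * p = 3 * p + p by ring]
  refine Nat.add_le_add ?_ ?_
  · let T : Finset (ZMod p × ZMod p) := Finset.univ.filter fun ab =>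
      ab.1 ≠ 0 ∧ w.d * ab.2 ^ 3 + 9 * ab.1 * w.c * ab.2 ^ 2 + 27 * ab.1 ^ 2 * w.b * ab.2 + 27 * ab.1 ^ 3 * w.a = 0
    have hmaps : Set.MapsTo (fun y : BinaryCubic (ZMod p) => (y.a, y.b))
        ((((gradZero p).filter fun y => dot w y = 0).filter fun y => y.a ≠ 0) : Finset _) T := by
      intro y hy
      simp only [gradZero, Finset.coe_filter, Finset.mem_filter, Finset.mem_univ, true_and, Set.mem_setOf_eq] at hy
      obtain ⟨⟨hg, hdot⟩, ha⟩ := hy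
      simp only [T, Finset.coe_filter, Finset.mem_univ, true_and, Set.mem_setOf_eq]
      refine ⟨ha, ?_⟩
      obtain ⟨r1, r2⟩ := rel_of_gradZero hp5 hg
      simp only [dot] at hdot
      linear_combination 27 * y.a ^ 2 * hdot - 9 * y.a * w.c * r1 - w.d * r2
    have hinj : Set.InjOn (fun y : BinaryCubic (ZMod p) => (y.a, y.b))
        ((((gradZero p).filter fun y => dot w y = 0).filter fun y => y.a ≠ 0) : Finset _) := by
      intro y hy y' hy' h
      simp only [gradZero, Finset.coe_filter, Finset.mem_filter, Finset.mem_univ, true_and, Set.mem_setOf_eq] at hy hy'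
      simp only [Prod.mk.injEq] at h
      exact injOn_ab_gradZero hp5 hy.1.1 hy'.1.1 hy.2 h.1 h.2
    refine le_trans (Finset.card_le_card_of_injOn _ hmaps hinj) ?_
    have hT : T.card = ∑ a : ZMod p, (Finset.univ.filter fun b : ZMod p =>
        a ≠ 0 ∧ w.d * b ^ 3 + 9 * a * w.c * b ^ 2 + 27 * a ^ 2 * w.b * b + 27 * a ^ 3 * w.a = 0).card := by
      simp only [T, Finset.card_filter]
      rw [Fintype.sum_prod_type]
    rw [hT, show 3 * p = ∑ _a : ZMod p, 3 by rw [Finset.sum_const, Finset.card_univ, ZMod.card, smul_eq_mul, mul_comm]]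
    refine Finset.sum_le_sum fun a _ => ?_
    by_cases ha : a = 0
    · simp [ha]
    · set K : Cubic (ZMod p) := ⟨w.d, 9 * a * w.c, 27 * a ^ 2 * w.b, 27 * a ^ 3 * w.a⟩
      have hK : K.toPoly ≠ 0 := Cubic.ne_zero_of_a_ne_zero hw
      refine le_trans (le_of_eq ?_) (card_filter_cubic_le hK)
      congr 1
      refine Finset.filter_congr fun b _ => ?_
      simp only [ha, ne_eq, not_false_eq_true, true_and]
      constructor <;> intro h <;> linear_combination h
  · have := card_gradZero_a_eq_zero_le hp5 (fun y => dot w y = 0)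
    refine le_trans (le_of_eq ?_) this
    congr 1
    ext y
    simp only [Finset.mem_filter, not_not]
    tauto

end ContentBounds

section ContentFinal

variable {p : ℕ} [hp : Fact p.Prime]

/-! ### Normalisation `p ∤ a` by `SL₂(ℤ)` and the bound `|Ψ̂_{p²}(ι⁻¹(p f'))| ≤ 9 p⁻³` -/

omit hp in
/-- `(γ · f)_a = f(γ₀₀, γ₀₁)` for `det γ = 1`. [folklore] -/
theorem twist_a_of_det_one (γ : Matrix (Fin 2) (Fin 2) ℤ) (hdet : γ.det = 1) (f : BinaryCubic ℤ) :
    (twist γ f).a = f.eval (γ 0 0) (γ 0 1) := by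
  rw [twist, hdet, one_smul]
  simp only [BinaryCubic.subst, eval]

/-- **A form `f' ≢ 0 (mod p)` takes a value `≢ 0 (mod p)` at some `(1, t)`** (`p ≥ 5 > 3` points on the
line `u = 1` cannot all be zeros of a nonzero cubic), so the shear `(1 t; 0 1) ∈ SL₂(ℤ)` makes `p ∤ a`. [folklore] -/
theorem exists_sl2z_not_dvd_a (hp5 : 5 ≤ p) {f' : BinaryCubic ℤ} (hprim : ¬ f'.IsMultiple p) :
    ∃ γ : Matrix (Fin 2) (Fin 2) ℤ, γ.det = 1 ∧ ¬ (p : ℤ) ∣ (twist γ f').a := by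
  classical
  set F := f'.map (Int.castRingHom (ZMod p)) with hF
  set K : Cubic (ZMod p) := ⟨F.d, F.c, F.b, F.a⟩ with hK
  have hK0 : K.toPoly ≠ 0 := by
    intro h
    rw [Cubic.toPoly_eq_zero_iff] at h
    have hd : F.d = 0 := congrArg Cubic.a h
    have hc : F.c = 0 := congrArg Cubic.b h
    have hb : F.b = 0 := congrArg Cubic.c h
    have ha : F.a = 0 := congrArg Cubic.d h
    simp only [hF, map_a, map_b, map_c, map_d, eq_intCast, ZMod.intCast_zmod_eq_zero_iff_dvd] at ha hb hc hd
    exact hprim ⟨ha, hb, hc, hd⟩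
  have hcard : K.toPoly.roots.toFinset.card < (Finset.univ : Finset (ZMod p)).card := by
    rw [Finset.card_univ, ZMod.card]
    exact lt_of_le_of_lt Cubic.card_roots_le (by omega)
  obtain ⟨m, -, hm⟩ := Finset.exists_mem_notMem_of_card_lt_card hcard
  rw [Multiset.mem_toFinset, Polynomial.mem_roots hK0, Polynomial.IsRoot.def] at hm
  have heval : K.toPoly.eval m = F.eval 1 m := by
    simp only [hK, Cubic.toPoly, Polynomial.eval_add, Polynomial.eval_mul, Polynomial.eval_C, Polynomial.eval_pow,
      Polynomial.eval_X, eval]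
    ring
  refine ⟨!![1, (m.val : ℤ); 0, 1], by rw [Matrix.det_fin_two_of]; ring, fun hdvd => hm ?_⟩
  rw [heval]
  have ha : (twist !![1, (m.val : ℤ); 0, 1] f').a = f'.eval 1 (m.val : ℤ) := by
    rw [twist_a_of_det_one _ (by rw [Matrix.det_fin_two_of]; ring)]
    simp
  rw [ha] at hdvd
  have := eval_map (Int.castRingHom (ZMod p)) f' 1 (m.val : ℤ)
  rw [map_one, eq_intCast, Int.cast_natCast, ZMod.natCast_zmod_val, eq_intCast,
    (ZMod.intCast_zmod_eq_zero_iff_dvd _ _).mpr hdvd] at this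
  exact this

/-- **`|Ψ̂_{p²}(ι⁻¹ f)| ≤ 9 p⁻³` when `p ∥ f`** (`f = p f'` in the dual lattice with `f' ≢ 0 (mod p)`, `p ≥ 5`):
the "Content `p`" case of BTT Prop. 5.2 (`O(p⁻³)`). [cite: BhargavaTaniguchiThorne2023, Prop. 5.2 (Content p)] -/
theorem norm_fourierDual_psiLocal_le_of_isMultiple (hp5 : 5 ≤ p) {f : BinaryCubic ℤ} (hf : IsDualForm f)
    (hm : f.IsMultiple p) (hm2 : ¬ f.IsMultiple ((p : ℤ) ^ 2)) :
    ‖fourierDual (psiLocal p) f‖ ≤ 9 * ((p : ℝ) ^ 3)⁻¹ := by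
  obtain ⟨f', rfl⟩ := isMultiple_iff_exists_smul.mp hm
  have hp3 : ¬ (3 : ℤ) ∣ p := by
    intro h
    have := (Nat.prime_dvd_prime_iff_eq Nat.prime_three hp.out).mp (by exact_mod_cast h)
    omega
  have hf' : IsDualForm f' := by
    obtain ⟨hb, hc⟩ := hf
    simp only [smul_b, smul_c] at hb hc
    exact ⟨(Int.prime_three.dvd_or_dvd hb).resolve_left hp3, (Int.prime_three.dvd_or_dvd hc).resolve_left hp3⟩
  have hprim : ¬ f'.IsMultiple p := by
    rintro ⟨ha, hb, hc, hd⟩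
    apply hm2
    simp only [IsMultiple, smul_a, smul_b, smul_c, smul_d, sq]
    exact ⟨mul_dvd_mul_left _ ha, mul_dvd_mul_left _ hb, mul_dvd_mul_left _ hc, mul_dvd_mul_left _ hd⟩
  -- normalise `p ∤ a`
  obtain ⟨γ, hdet, hγa⟩ := exists_sl2z_not_dvd_a hp5 hprim
  have hγu : IsUnit γ.det := by rw [hdet]; exact isUnit_one
  rw [← fourierDual_psiLocal_twist hγu hf, twist_smul]
  set g' := twist γ f' with hg'
  have hg'dual : IsDualForm g' := hf'.twist γ
  set w := dualVec p g' with hw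
  have hwd : w.d ≠ 0 := by
    rw [hw, dualVec]
    show -((g'.a : ℤ) : ZMod p) ≠ 0
    rwa [neg_ne_zero, Ne, ZMod.intCast_zmod_eq_zero_iff_dvd]
  -- the formula and the two cone bounds
  have hreal : (p : ℝ) ^ 2 = ((p ^ 2 : ℕ) : ℝ) := by push_cast; ring
  have hp1 : (1 : ℝ) < p := by exact_mod_cast hp.out.one_lt
  have hp5r : (5 : ℝ) ≤ p := by exact_mod_cast hp5
  have hp0 : (0 : ℝ) < p := by linarith
  have hD := norm_sum_eMod_cone_le (fun s _ y hy => smul_mem_discZero s hy) w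
    (B := ((3 * p ^ 3 + p ^ 2 : ℕ) : ℝ)) (Bw := ((3 * p ^ 2 + p : ℕ) : ℝ))
    (Nat.cast_le.mpr (card_discZero_le hp5)) (Nat.cast_le.mpr (card_discZero_perp_le hp5 hwd))
  have hG := norm_sum_eMod_cone_le (fun s _ y hy => smul_mem_gradZero s hy) w
    (B := ((p ^ 2 + p : ℕ) : ℝ)) (Bw := ((4 * p : ℕ) : ℝ))
    (Nat.cast_le.mpr (card_gradZero_le hp5)) (Nat.cast_le.mpr (card_gradZero_perp_le hp5 hwd))
  -- simplify the maxima: `max(p(3p²+p), 3p³+p²)/(p−1) ≤ 4p²`, `max(p·4p, p²+p)/(p−1) ≤ 5p`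
  have hD' : ‖∑ y ∈ discZero p, eMod (dot w y)‖ ≤ 4 * (p : ℝ) ^ 2 := by
    refine le_trans hD ?_
    rw [div_le_iff₀ (by linarith), max_le_iff]
    constructor <;> push_cast <;> nlinarith
  have hG' : ‖∑ y ∈ gradZero p, eMod (dot w y)‖ ≤ 5 * (p : ℝ) := by
    refine le_trans hG ?_
    rw [div_le_iff₀ (by linarith), max_le_iff]
    constructor <;> push_cast <;> nlinarith
  rw [fourierDual_eq_sum, sum_psiLocal_mul_eMod_smul_p hp5 hg'dual, norm_mul, norm_inv, norm_pow]
  simp only [Nat.cast_pow, norm_pow, Complex.norm_natCast]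
  have hbound : ‖(p : ℂ) ^ 3 * ∑ y₀ ∈ discZero p, eMod (dot (dualVec p g') y₀) +
      ((p : ℂ) ^ 4 - (p : ℂ) ^ 3) * ∑ y₀ ∈ gradZero p, eMod (dot (dualVec p g') y₀)‖ ≤ 9 * (p : ℝ) ^ 5 := by
    rw [← hw]
    refine le_trans (norm_add_le _ _) ?_
    rw [norm_mul, norm_mul, norm_pow, Complex.norm_natCast,
      show ‖(p : ℂ) ^ 4 - (p : ℂ) ^ 3‖ = (p : ℝ) ^ 4 - (p : ℝ) ^ 3 by
        rw [show (p : ℂ) ^ 4 - (p : ℂ) ^ 3 = (((p : ℝ) ^ 4 - (p : ℝ) ^ 3 : ℝ) : ℂ) by push_cast; ring, Complex.norm_real,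
          Real.norm_eq_abs, abs_of_nonneg (by nlinarith [pow_le_pow_right₀ hp1.le (show 3 ≤ 4 by norm_num)])]]
    have h3 : 0 ≤ (p : ℝ) ^ 3 := by positivity
    have h43 : 0 ≤ (p : ℝ) ^ 4 - (p : ℝ) ^ 3 := by nlinarith [pow_le_pow_right₀ hp1.le (show 3 ≤ 4 by norm_num)]
    calc (p : ℝ) ^ 3 * ‖∑ y ∈ discZero p, eMod (dot w y)‖ + ((p : ℝ) ^ 4 - (p : ℝ) ^ 3) * ‖∑ y ∈ gradZero p, eMod (dot w y)‖
        ≤ (p : ℝ) ^ 3 * (4 * (p : ℝ) ^ 2) + ((p : ℝ) ^ 4 - (p : ℝ) ^ 3) * (5 * p) :=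
          add_le_add (mul_le_mul_of_nonneg_left hD' h3) (mul_le_mul_of_nonneg_left hG' h43)
      _ ≤ 9 * (p : ℝ) ^ 5 := by nlinarith [pow_pos hp0 4]
  calc (((p : ℝ) ^ 2) ^ 4)⁻¹ * ‖(p : ℂ) ^ 3 * ∑ y₀ ∈ discZero p, eMod (dot (dualVec p g') y₀) +
        ((p : ℂ) ^ 4 - (p : ℂ) ^ 3) * ∑ y₀ ∈ gradZero p, eMod (dot (dualVec p g') y₀)‖
      ≤ (((p : ℝ) ^ 2) ^ 4)⁻¹ * (9 * (p : ℝ) ^ 5) := mul_le_mul_of_nonneg_left hbound (by positivity)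
    _ = 9 * ((p : ℝ) ^ 3)⁻¹ := by field_simp

end ContentFinal

end Literature.NumberTheory.CubicFields

end
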